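import Literature.AlgebraicGeometry.ShimuraVarieties.UnitaryCurveAuxiliaryLevelContainmentV
import HarnessLib

/-!
# Frame data for the `W₀`-free auxiliary chart: scalar readings of the carrier, the level containment and the INTEGER reading of the
# `𝒪`-action from a frame matrix `P = T·γ` (any rank `n`)

Topic `AlgebraicGeometry/ShimuraVarieties`; namespace `Literature.AlgebraicGeometry.ShimuraVarieties.UnitaryCurve.AuxV`.
Theorems only (no definition, no named fact, no instance).  Cell `hodgecm-mathlib` (D-0151), FLOOR 0, P6 «MOD programme», door (E) of
`stub_RGD`, organ **E1 FILE 7b (part 1 of 2: frame data)** — the engine behind the (M) fields of the E-LINE chart `AuxChartGS` of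
`Cruxes/HLiu418/Lines/F0_P6a_PELWitnessE.lean` (`Mρ : 𝓞 F →+* Matrix (Fin g ⊕ Fin g) (Fin g ⊕ Fin g) ℤ`); the existence theorem and its
consequences are ★ `UnitaryCurveAuxiliaryIntegralActionV` (part 2).  `--supports stmt-HodgeConjecture-24832`, count-neutral; HC_CM is proved only
modulo the printed citations until rung 0 closes.

THE POINT ([Kottwitz1992] §5 p. 390: the PEL moduli problem needs an `𝒪_B`-LATTICE `Λ` stabilised by the level; [RapoportSmithlingZhang2020Diagonal]
§4.1 p. 17: `𝒪_F`-action `ι : 𝒪_F → End(A)` with Rosati `ι(b̄) = ι(b)^†`): the symplectic frame `β` of ★ E1 FILES 5∕6 is adapted to a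
`K`-stable **ℤ**-lattice `β⁻¹(ℤ^{2g})`; for multiplication by `b ∈ 𝓞_M` to have an INTEGER matrix in the frame the lattice must moreover be
`𝓞_M`-stable.  ★ `Adeles.exists_rat_conj_entries_mem_integralFiniteAdeles_of_commute` (FILE 7a: a compact subgroup and a commuting order
stabilise a common lattice) applied to the compact image of `K × L₀` under ★ `auxResFinV` and to the order `{res(b•1) : b ∈ 𝓞_M}`
(which commutes with the `(𝔸_f ⊗ M)`-linear carrier) gives such a lattice; ★ `exists_symplecticFrameV_integral` adapts the frame.

* §1 generic-`R` scalar readings: `resMatrix_map_algebraMap` (`res` commutes with `ℚ → R`), `coe_auxRepV_scalar_eq_map`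
  (`auxRepV R β (1⊗b, 1) = (P·res(b•1)·Q)_R`), `auxRepV_scalar_mul_comm` (scalars are central in the carrier).
* §2 `prod_le_auxLevelV_one_of_framePV_eq`: the level containment `K × L₀ ≤ K̃_V(1)` from frame data `P = T·γ` (the engine of ★ FILE 6, exposed).
* §3 `exists_ringHom_reading_of_framePV_eq`: from `P = T·γ`, `Q = γ⁻¹·T′` and `γ·res(b•1)·γ⁻¹ ∈ M(ℤ)` (`b ∈ 𝓞_M`), an INTEGER ring
  homomorphism `ρ : 𝓞 M →+* M_{2g}(ℤ)` with `(ρ b)_ℚ = P·res(b•1)·Q`.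
(Part 2, ★ `UnitaryCurveAuxiliaryIntegralActionV`: HEAD `exists_symplecticFrameV_integralAction` and the consequences — ℤ-Rosati, the
`R`-avatar `(ρ b)_R = auxRepV R Fr (1⊗b, 1)`, commutation with the carrier.)

## References
* [Kottwitz1992] R. Kottwitz, *Points on some Shimura varieties over finite fields*, JAMS 5 (1992), §5 p. 390.
* [RapoportSmithlingZhang2020Diagonal] M. Rapoport, B. Smithling, W. Zhang, Compos. Math. 156 (2020), Remark 3.2 (ii)(iii) pp. 9–10, §4.1 p. 17.
* [Deligne1979ShimuraVarieties] P. Deligne, *Variétés de Shimura* (1979), Prop. 2.3.10 (PDF p. 32 of Milne's translation).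
* [Milne2005ShimuraVarieties] J. S. Milne, *Introduction to Shimura varieties* (2005), §6 p. 67, §8 p. 81.
* [PlatonovRapinchuk1994] V. Platonov, A. Rapinchuk, *Algebraic groups and number theory* (1994), §8.1.
-/

set_option autoImplicit false

noncomputable section

open Matrix NumberField IsDedekindDomain
open scoped TensorProduct
open Literature.AlgebraicGeometry.ModuliOfAbelianVarieties Literature.LinearAlgebra.FreeModule
open Literature.NumberTheory.Automorphic (integralFiniteAdeles)

namespace Literature.AlgebraicGeometry.ShimuraVarieties

namespace UnitaryCurve

namespace AuxV

open Literature.AlgebraicGeometry.ShimuraVarieties.UnitaryCanonicalModel.Aux (ratBasis torusFinAdelic torusToTensorFin map_intCast_mul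
  isCongOne_one_of_forall_mem_integral forall_mem_integral_intConj)
open Literature.AlgebraicGeometry.ShimuraVarieties.UnitaryCurve.Aux (unitaryToTensorFin)
open Literature.NumberTheory.Automorphic Literature.NumberTheory.Automorphic.UnitaryGroup

/-! ### §1. Generic-`R` scalar readings of the carrier -/

section Scalar

variable {L : Type} [Field L] (M : Type) [Field M] [NumberField M] [IsCMField M] {j : L →+* M}
  {n : ℕ} {H : Matrix (Fin n) (Fin n) L} {ξ : M} {g : ℕ} {δ : Fin g → ℕ} (R : Type) [CommRing R] [Algebra ℚ R]

omit [IsCMField M] in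
/-- `res` commutes with the base change `M → R ⊗_ℚ M` read in the bases `b` and `1 ⊗ b` (any `ℚ`-algebra `R`; ★ E2 FILE D's
`resMatrix_map_algebraMap_eq` is the case `R = ℝ`). [cite: Deligne1979ShimuraVarieties, Prop. 2.3.10 (PDF p. 32)] -/
theorem resMatrix_map_algebraMap (A : Matrix (Fin n) (Fin n) M) :
    (resMatrix (m := Fin n) (ratBasis M) A).map (algebraMap ℚ R) =
      resMatrix (Algebra.TensorProduct.basis R (ratBasis M)) (A.map (Algebra.TensorProduct.includeRight : M →ₐ[ℚ] R ⊗[ℚ] M)) := by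
  ext ⟨i, l⟩ ⟨i', l'⟩
  rw [Matrix.map_apply, resMatrix_apply, resMatrix_apply, Matrix.map_apply, Algebra.TensorProduct.basis_apply,
    Algebra.TensorProduct.includeRight_apply, Algebra.TensorProduct.tmul_mul_tmul, one_mul,
    Algebra.TensorProduct.basis_repr_tmul, one_smul, Finsupp.mapRange_apply]

omit [IsCMField M] in
/-- A non-zero `b ∈ M` gives the unit `1 ⊗ b` of `R ⊗_ℚ M`. [cite: Milne2005ShimuraVarieties, §8 p. 81] -/
theorem exists_tensorUnit_coe_eq_one_tmul (b : M) (hb : b ≠ 0) : ∃ t : (R ⊗[ℚ] M)ˣ, (t : R ⊗[ℚ] M) = (1 : R) ⊗ₜ[ℚ] b :=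
  ⟨Units.map ((Algebra.TensorProduct.includeRight : M →ₐ[ℚ] R ⊗[ℚ] M) : M →* R ⊗[ℚ] M) (Units.mk0 b hb), rfl⟩

/-- **The scalar `1 ⊗ b` read in the frame over `R` is the base change of the rational frame matrix of `b`**:
`auxRepV R β (t, 1) = (P·res(b•1)·Q).map (ℚ → R)` for `t = 1 ⊗ b`. [cite: Milne2005ShimuraVarieties, §6 p. 67, §8 p. 81] -/
theorem coe_auxRepV_scalar_eq_map (F : SymplecticFrameV M j H ξ g δ) (t : (R ⊗[ℚ] M)ˣ) (b : M)
    (ht : (t : R ⊗[ℚ] M) = (1 : R) ⊗ₜ[ℚ] b) :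
    ((auxRepV R F (t, 1) : GL (Fin g ⊕ Fin g) R) : Matrix (Fin g ⊕ Fin g) (Fin g ⊕ Fin g) R) =
      (framePV F * resMatrix (m := Fin n) (ratBasis M) (b • (1 : Matrix (Fin n) (Fin n) M)) * frameQV F).map (algebraMap ℚ R) := by
  rw [auxRepV, MonoidHom.comp_apply, MonoidHom.comp_apply, coe_conjRect, coe_resGL, coe_blockGLV, Units.val_one, Matrix.map_mul,
    Matrix.map_mul, framePVR, frameQVR, resMatrix_map_algebraMap, ht,
    Matrix.map_smul' _ _ _ (map_mul (Algebra.TensorProduct.includeRight : M →ₐ[ℚ] R ⊗[ℚ] M)),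
    Matrix.map_one _ (map_zero _) (map_one _), Algebra.TensorProduct.includeRight_apply]

/-- **Scalars are central in the carrier**: `auxRepV R β (t, 1)` commutes with every `auxRepV R β p`. [cite: Milne2005ShimuraVarieties, §8 p. 81] -/
theorem auxRepV_scalar_mul_comm (F : SymplecticFrameV M j H ξ g δ) (t : (R ⊗[ℚ] M)ˣ) (p : (R ⊗[ℚ] M)ˣ × GL (Fin n) (R ⊗[ℚ] M)) :
    auxRepV R F (t, 1) * auxRepV R F p = auxRepV R F p * auxRepV R F (t, 1) := by
  obtain ⟨t', X⟩ := p
  rw [← map_mul, ← map_mul, Prod.mk_mul_mk, Prod.mk_mul_mk, one_mul, mul_one, mul_comm t t']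

end Scalar

/-! ### §2. The level containment from frame data -/

section Level

variable {L : Type} [Field L] [NumberField L] [IsCMField L] {M : Type} [Field M] [NumberField M] [IsCMField M]
  {j : L →+* M} {n : ℕ} {H : Matrix (Fin n) (Fin n) L} {ξ : M} {g : ℕ} {δ : Fin g → ℕ}

/-- **`K × L₀ ≤ K̃_V(1)` from frame data** (the engine of ★ FILE 6 `exists_symplecticFrameV_prod_le_auxLevelV_one`, exposed): if the frame
matrix is `P = T·γ`, `Q = γ⁻¹·T′` with `T, T′` inverse INTEGER matrices and `γ ∈ GL(ℚ)` conjugating the image of `K × L₀` under ★ `auxResFinV`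
into `GL(ℤ̂)`, then `ũ_β(K × L₀) ≤ K_δ(1)`. [cite: Deligne1979ShimuraVarieties, Prop. 2.3.10 (PDF p. 32)] [cite: Deligne1971TravauxShimura, Prop. 1.15 p. 132] -/
theorem prod_le_auxLevelV_one_of_framePV_eq (F : SymplecticFrameV M j H ξ g δ)
    (K : Subgroup ↥(finAdelic (↥(maximalRealSubfield L)) L (IsCMField.complexConj L) n H)) (L₀ : Subgroup ↥(torusFinAdelic M))
    (γ : GL (Fin n × Fin (Module.finrank ℚ M)) ℚ)
    (hγ : ∀ p ∈ K.prod L₀,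
      (∀ i k, ((Matrix.GeneralLinearGroup.map (algebraMap ℚ finAdeleQ) γ * auxResFinV M j H p *
          (Matrix.GeneralLinearGroup.map (algebraMap ℚ finAdeleQ) γ)⁻¹ : GL (Fin n × Fin (Module.finrank ℚ M)) finAdeleQ) :
            Matrix (Fin n × Fin (Module.finrank ℚ M)) (Fin n × Fin (Module.finrank ℚ M)) finAdeleQ) i k ∈ integralFiniteAdeles ℚ) ∧
      (∀ i k, ((Matrix.GeneralLinearGroup.map (algebraMap ℚ finAdeleQ) γ * (auxResFinV M j H p)⁻¹ *
          (Matrix.GeneralLinearGroup.map (algebraMap ℚ finAdeleQ) γ)⁻¹ : GL (Fin n × Fin (Module.finrank ℚ M)) finAdeleQ) :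
            Matrix (Fin n × Fin (Module.finrank ℚ M)) (Fin n × Fin (Module.finrank ℚ M)) finAdeleQ) i k ∈ integralFiniteAdeles ℚ))
    (T : Matrix (Fin g ⊕ Fin g) (Fin n × Fin (Module.finrank ℚ M)) ℤ) (T' : Matrix (Fin n × Fin (Module.finrank ℚ M)) (Fin g ⊕ Fin g) ℤ)
    (hT'T : T' * T = 1)
    (hP : framePV F = T.map (Int.cast : ℤ → ℚ) * ((γ : GL (Fin n × Fin (Module.finrank ℚ M)) ℚ) :
      Matrix (Fin n × Fin (Module.finrank ℚ M)) (Fin n × Fin (Module.finrank ℚ M)) ℚ)) :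
    K.prod L₀ ≤ auxLevelV F 1 := by
  classical
  set γm : Matrix (Fin n × Fin (Module.finrank ℚ M)) (Fin n × Fin (Module.finrank ℚ M)) ℚ :=
    ((γ : GL (Fin n × Fin (Module.finrank ℚ M)) ℚ) : Matrix (Fin n × Fin (Module.finrank ℚ M)) (Fin n × Fin (Module.finrank ℚ M)) ℚ)
    with hγm
  set γi : Matrix (Fin n × Fin (Module.finrank ℚ M)) (Fin n × Fin (Module.finrank ℚ M)) ℚ :=
    ((γ⁻¹ : GL (Fin n × Fin (Module.finrank ℚ M)) ℚ) : Matrix (Fin n × Fin (Module.finrank ℚ M)) (Fin n × Fin (Module.finrank ℚ M)) ℚ)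
    with hγi
  have hγim : γi * γm = 1 := by rw [hγm, hγi, ← Units.val_mul, inv_mul_cancel, Units.val_one]
  set Tq : Matrix (Fin g ⊕ Fin g) (Fin n × Fin (Module.finrank ℚ M)) ℚ := T.map (Int.cast : ℤ → ℚ) with hTq
  set T'q : Matrix (Fin n × Fin (Module.finrank ℚ M)) (Fin g ⊕ Fin g) ℚ := T'.map (Int.cast : ℤ → ℚ) with hT'q
  have hT'Tq : T'q * Tq = 1 := by
    rw [hTq, hT'q, ← map_intCast_mul, hT'T, Matrix.map_one Int.cast Int.cast_zero Int.cast_one]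
  have hQ : frameQV F = γi * T'q := by
    have h1 : (γi * T'q) * framePV F = 1 := by
      rw [hP, Matrix.mul_assoc, ← Matrix.mul_assoc T'q, hT'Tq, Matrix.one_mul, hγim]
    calc frameQV F = (γi * T'q) * framePV F * frameQV F := by rw [h1, Matrix.one_mul]
      _ = γi * T'q := by rw [Matrix.mul_assoc, framePV_mul_frameQV, Matrix.mul_one]
  -- over `𝔸_{ℚ,f}`
  set ι𝔸 : ℚ →+* finAdeleQ := algebraMap ℚ finAdeleQ with hι
  have hPA : framePVR finAdeleQ F = T.map (Int.cast : ℤ → finAdeleQ) * γm.map ι𝔸 := by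
    rw [framePVR, hP, ← hι, Matrix.map_mul, Matrix.map_map]
    congr 1
    ext a ik
    simp only [Matrix.map_apply, Function.comp_apply, map_intCast]
  have hQA : frameQVR finAdeleQ F = γi.map ι𝔸 * T'.map (Int.cast : ℤ → finAdeleQ) := by
    rw [frameQVR, hQ, ← hι, Matrix.map_mul, hT'q, Matrix.map_map]
    congr 1
    ext ik a
    simp only [Matrix.map_apply, Function.comp_apply, map_intCast]
  have hγA : ((Matrix.GeneralLinearGroup.map ι𝔸 γ : GL (Fin n × Fin (Module.finrank ℚ M)) finAdeleQ) :
      Matrix (Fin n × Fin (Module.finrank ℚ M)) (Fin n × Fin (Module.finrank ℚ M)) finAdeleQ) = γm.map ι𝔸 := rfl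
  have hγA' : (((Matrix.GeneralLinearGroup.map ι𝔸 γ)⁻¹ : GL (Fin n × Fin (Module.finrank ℚ M)) finAdeleQ) :
      Matrix (Fin n × Fin (Module.finrank ℚ M)) (Fin n × Fin (Module.finrank ℚ M)) finAdeleQ) = γi.map ι𝔸 := by
    rw [← map_inv]; rfl
  rintro p hp
  obtain ⟨h1, h2⟩ := hγ p hp
  rw [mem_auxLevelV_iff]
  have key : ∀ Z : GL (Fin n × Fin (Module.finrank ℚ M)) finAdeleQ,
      (∀ i k, ((Matrix.GeneralLinearGroup.map ι𝔸 γ * Z * (Matrix.GeneralLinearGroup.map ι𝔸 γ)⁻¹ :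
        GL (Fin n × Fin (Module.finrank ℚ M)) finAdeleQ) :
          Matrix (Fin n × Fin (Module.finrank ℚ M)) (Fin n × Fin (Module.finrank ℚ M)) finAdeleQ) i k ∈ integralFiniteAdeles ℚ) →
      IsCongOne 1 (framePVR finAdeleQ F *
        (Z : Matrix (Fin n × Fin (Module.finrank ℚ M)) (Fin n × Fin (Module.finrank ℚ M)) finAdeleQ) * frameQVR finAdeleQ F) := by
    intro Z hZ
    rw [Units.val_mul, Units.val_mul, hγA, hγA'] at hZ
    have hmul : framePVR finAdeleQ F * (Z : Matrix (Fin n × Fin (Module.finrank ℚ M)) (Fin n × Fin (Module.finrank ℚ M)) finAdeleQ) *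
          frameQVR finAdeleQ F =
        T.map (Int.cast : ℤ → finAdeleQ) *
            (γm.map ι𝔸 * (Z : Matrix (Fin n × Fin (Module.finrank ℚ M)) (Fin n × Fin (Module.finrank ℚ M)) finAdeleQ) * γi.map ι𝔸) *
          T'.map (Int.cast : ℤ → finAdeleQ) := by
      rw [hPA, hQA]
      simp only [Matrix.mul_assoc]
    rw [hmul]
    exact isCongOne_one_of_forall_mem_integral (forall_mem_integral_intConj T T' hZ)
  refine ⟨?_, ?_⟩
  · rw [coe_auxToGspFinV_eq_conjRect]
    exact key _ h1
  · rw [coe_auxToGspFinV_eq_conjRect, ← map_inv]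
    exact key _ h2

end Level

/-! ### §3. The integral reading of the `𝒪`-action from frame data -/

section Reading

variable {L : Type} [Field L] {M : Type} [Field M] [NumberField M] [IsCMField M]
  {j : L →+* M} {n : ℕ} {H : Matrix (Fin n) (Fin n) L} {ξ : M} {g : ℕ} {δ : Fin g → ℕ}

/-- An integer matrix is determined by its rational image. [cite: PlatonovRapinchuk1994, §8.1] -/
private theorem map_intCast_injective {m m' : Type} :
    Function.Injective (fun A : Matrix m m' ℤ => A.map (Int.cast : ℤ → ℚ)) := fun A B h => by
  ext i k
  have := congrFun (congrFun h i) k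
  simpa only [Matrix.map_apply, Int.cast_inj] using this

/-- **The integral reading.**  If the frame matrix is `P = T·γ`, `T ∈ GL(ℤ)` with inverse `T′`, `γ ∈ GL(ℚ)`, and `γ·res(b•1)·γ⁻¹` is an
INTEGER matrix for every `b ∈ 𝓞_M` (the lattice `γ⁻¹ℤ^{n[M:ℚ]}` is `𝓞_M`-stable), then multiplication by `𝓞_M` on `V_M` reads in the frame as
an integer ring homomorphism `ρ : 𝓞 M →+* M_{2g}(ℤ)` with `(ρ b)_ℚ = P·res(b•1)·Q`. [cite: Kottwitz1992, §5 p. 390]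
[cite: Milne2005ShimuraVarieties, §6 p. 67] -/
theorem exists_ringHom_reading_of_framePV_eq (F : SymplecticFrameV M j H ξ g δ)
    (γ : GL (Fin n × Fin (Module.finrank ℚ M)) ℚ)
    (T : Matrix (Fin g ⊕ Fin g) (Fin n × Fin (Module.finrank ℚ M)) ℤ) (T' : Matrix (Fin n × Fin (Module.finrank ℚ M)) (Fin g ⊕ Fin g) ℤ)
    (hT'T : T' * T = 1)
    (hP : framePV F = T.map (Int.cast : ℤ → ℚ) * ((γ : GL (Fin n × Fin (Module.finrank ℚ M)) ℚ) :
      Matrix (Fin n × Fin (Module.finrank ℚ M)) (Fin n × Fin (Module.finrank ℚ M)) ℚ))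
    (hS : ∀ b : 𝓞 M, ∀ i k, ∃ z : ℤ,
      (((γ : GL (Fin n × Fin (Module.finrank ℚ M)) ℚ) : Matrix (Fin n × Fin (Module.finrank ℚ M)) (Fin n × Fin (Module.finrank ℚ M)) ℚ) *
          resMatrix (m := Fin n) (ratBasis M) (((b : 𝓞 M) : M) • (1 : Matrix (Fin n) (Fin n) M)) *
        ((γ⁻¹ : GL (Fin n × Fin (Module.finrank ℚ M)) ℚ) : Matrix (Fin n × Fin (Module.finrank ℚ M)) (Fin n × Fin (Module.finrank ℚ M)) ℚ))
        i k = (z : ℚ)) :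
    ∃ ρ : 𝓞 M →+* Matrix (Fin g ⊕ Fin g) (Fin g ⊕ Fin g) ℤ,
      ∀ b : 𝓞 M, (ρ b).map (Int.cast : ℤ → ℚ) =
        framePV F * resMatrix (m := Fin n) (ratBasis M) (((b : 𝓞 M) : M) • (1 : Matrix (Fin n) (Fin n) M)) * frameQV F := by
  classical
  set γm : Matrix (Fin n × Fin (Module.finrank ℚ M)) (Fin n × Fin (Module.finrank ℚ M)) ℚ :=
    ((γ : GL (Fin n × Fin (Module.finrank ℚ M)) ℚ) : Matrix (Fin n × Fin (Module.finrank ℚ M)) (Fin n × Fin (Module.finrank ℚ M)) ℚ)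
    with hγm
  set γi : Matrix (Fin n × Fin (Module.finrank ℚ M)) (Fin n × Fin (Module.finrank ℚ M)) ℚ :=
    ((γ⁻¹ : GL (Fin n × Fin (Module.finrank ℚ M)) ℚ) : Matrix (Fin n × Fin (Module.finrank ℚ M)) (Fin n × Fin (Module.finrank ℚ M)) ℚ)
    with hγi
  have hγim : γi * γm = 1 := by rw [hγm, hγi, ← Units.val_mul, inv_mul_cancel, Units.val_one]
  set Tq : Matrix (Fin g ⊕ Fin g) (Fin n × Fin (Module.finrank ℚ M)) ℚ := T.map (Int.cast : ℤ → ℚ) with hTq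
  set T'q : Matrix (Fin n × Fin (Module.finrank ℚ M)) (Fin g ⊕ Fin g) ℚ := T'.map (Int.cast : ℤ → ℚ) with hT'q
  have hT'Tq : T'q * Tq = 1 := by
    rw [hTq, hT'q, ← map_intCast_mul, hT'T, Matrix.map_one Int.cast Int.cast_zero Int.cast_one]
  have hQ : frameQV F = γi * T'q := by
    have h1 : (γi * T'q) * framePV F = 1 := by
      rw [hP, Matrix.mul_assoc, ← Matrix.mul_assoc T'q, hT'Tq, Matrix.one_mul, hγim]
    calc frameQV F = (γi * T'q) * framePV F * frameQV F := by rw [h1, Matrix.one_mul]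
      _ = γi * T'q := by rw [Matrix.mul_assoc, framePV_mul_frameQV, Matrix.mul_one]
  -- the rational reading as a ring homomorphism
  let σ : 𝓞 M →+* Matrix (Fin n × Fin (Module.finrank ℚ M)) (Fin n × Fin (Module.finrank ℚ M)) ℚ :=
    (resMatrix (m := Fin n) (ratBasis M)).comp ((algebraMap M (Matrix (Fin n) (Fin n) M)).comp (algebraMap (𝓞 M) M))
  have hσ : ∀ b : 𝓞 M, σ b = resMatrix (m := Fin n) (ratBasis M) (((b : 𝓞 M) : M) • (1 : Matrix (Fin n) (Fin n) M)) := fun b => by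
    simp only [σ, RingHom.comp_apply, Algebra.algebraMap_eq_smul_one]
  let ρQ : 𝓞 M →+* Matrix (Fin g ⊕ Fin g) (Fin g ⊕ Fin g) ℚ :=
    { toFun := fun b => framePV F * σ b * frameQV F
      map_one' := by rw [map_one, Matrix.mul_one, framePV_mul_frameQV]
      map_mul' := fun x y => by
        rw [map_mul]
        calc framePV F * (σ x * σ y) * frameQV F
            = framePV F * σ x * (frameQV F * framePV F) * σ y * frameQV F := by
              rw [frameQV_mul_framePV, Matrix.mul_one]; simp only [Matrix.mul_assoc]
          _ = framePV F * σ x * frameQV F * (framePV F * σ y * frameQV F) := by simp only [Matrix.mul_assoc]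
      map_zero' := by rw [map_zero, Matrix.mul_zero, Matrix.zero_mul]
      map_add' := fun x y => by rw [map_add, Matrix.mul_add, Matrix.add_mul] }
  have hρQ : ∀ b, ρQ b = framePV F * σ b * frameQV F := fun b => rfl
  -- integrality: `P σ(b) Q = T (γ σ(b) γ⁻¹) T′`
  have hint : ∀ b : 𝓞 M, ∃ Z : Matrix (Fin g ⊕ Fin g) (Fin g ⊕ Fin g) ℤ, ρQ b = Z.map (Int.cast : ℤ → ℚ) := by
    intro b
    choose z hz using hS b
    refine ⟨T * (Matrix.of fun i k => z i k) * T', ?_⟩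
    have hZ : γm * σ b * γi = (Matrix.of fun i k => z i k).map (Int.cast : ℤ → ℚ) := by
      ext i k
      rw [Matrix.map_apply, Matrix.of_apply, ← hz i k, hσ]
    rw [hρQ, hP, hQ, map_intCast_mul, map_intCast_mul, ← hZ, ← hTq, ← hT'q]
    simp only [Matrix.mul_assoc]
  choose Z hZ using hint
  have h1 : Z 1 = 1 := map_intCast_injective (by
    change (Z 1).map (Int.cast : ℤ → ℚ) = (1 : Matrix _ _ ℤ).map (Int.cast : ℤ → ℚ)
    rw [← hZ, map_one, Matrix.map_one Int.cast Int.cast_zero Int.cast_one])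
  have hmul : ∀ x y, Z (x * y) = Z x * Z y := fun x y => map_intCast_injective (by
    change (Z (x * y)).map (Int.cast : ℤ → ℚ) = (Z x * Z y).map (Int.cast : ℤ → ℚ)
    rw [← hZ, map_mul, hZ, hZ, map_intCast_mul])
  have h0 : Z 0 = 0 := map_intCast_injective (by
    change (Z 0).map (Int.cast : ℤ → ℚ) = (0 : Matrix _ _ ℤ).map (Int.cast : ℤ → ℚ)
    rw [← hZ, map_zero, Matrix.map_zero Int.cast Int.cast_zero])
  have hadd : ∀ x y, Z (x + y) = Z x + Z y := fun x y => map_intCast_injective (by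
    change (Z (x + y)).map (Int.cast : ℤ → ℚ) = (Z x + Z y).map (Int.cast : ℤ → ℚ)
    rw [← hZ, map_add, hZ, hZ, Matrix.map_add _ Int.cast_add])
  let ρ : 𝓞 M →+* Matrix (Fin g ⊕ Fin g) (Fin g ⊕ Fin g) ℤ :=
    { toFun := Z, map_one' := h1, map_mul' := hmul, map_zero' := h0, map_add' := hadd }
  refine ⟨ρ, fun b => ?_⟩
  change (Z b).map (Int.cast : ℤ → ℚ) = _
  rw [← hZ, hρQ, hσ]

end Reading

end AuxV

end UnitaryCurve

end Literature.AlgebraicGeometry.ShimuraVarieties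

end
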